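import Summits.AtomisticToContinuum.BoseEinsteinCondensation.Theorems.BECConjugateDominationHardCoreExtensionWeightedLogGradientBoundTools
import Literature.MathematicalPhysics.QuantumManyBody.PeriodicFormCauchySchwarz
import Literature.MathematicalPhysics.QuantumManyBody.PeriodicSlotDepletion
import HarnessLib
-- module: Summits.AtomisticToContinuum.BoseEinsteinCondensation.Theorems.BECRewardDescentRewardChordBoundTeleportTest

/-!
# The teleport lemma, part 1/2 (crux `RewardChordBound`, stmt-AtomisticToContinuum-12876, stub R2 `stub_teleportPackage`,
# helper file 2a): the test directions `(θ - cη)⁺` and the decay of their kinetic pairing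

Setting: the REWARDED maximal form `maxForm v L η + s·depletion N η` of the periodic `N`-boson gas with a
condensate reward `-s n̂₀ = -s ∑ᵢ Pᵢ` (`Pᵢ` = slot average, `= η - exciteProj N i η` on `L²`), for an ARBITRARY
measurable pair profile `v` (hard cores allowed). Let `η ≥ 0` be Bose-symmetric of finite maximal form and satisfy the
Euler–Lagrange identity `KinB(η, ξ) + PotB(η, ξ) + s·DepB(η, ξ) = R re⟪η, ξ⟫` for all Bose-symmetric `ξ` of finite
maximal form (the rewarded ground states do, stub R1). **Teleport lemma** (`ae_sub_exciteProj_eq_zero_of_eulerLagrange`):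
for every Bose-symmetric `θ ≥ 0` of finite maximal form and every slot `i`,
`(Pᵢη)(t) = 0` for a.e. `t` with `η(t) = 0` and `θ(t) ≠ 0`.

Proof (form level, no semigroup, no local regularity; THIS FILE: the algebra of `KinB` — symmetry, linearity,
Cauchy–Schwarz from the polarisation identity — and the test directions with their pointwise behaviour; part 2
runs the limit). Test the identity against `ξ_c = (θ - cη)⁺`, `c → ∞`:
* `ξ_c → θ𝟙{η=0}` pointwise, dominated by `θ`, so `re⟪η, ξ_c⟫ → 0`, `PotB(η, ξ_c) → 0` (`η·θ𝟙{η=0} = 0`) and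
  `DepB(η, ξ_c) → -∑ᵢ ∫ (Pᵢη) θ 𝟙{η=0}` (dominated convergence; `DepB(η, ζ) = ∑ᵢ re⟪η - Pᵢη, ζ⟫`), each summand
  `∫ (Pᵢη) θ 𝟙{η=0}` being `≥ 0` because `Pᵢη ≥ 0` (slot average of a non-negative class, helper file 1);
* `KinB(η, ξ_c) = ½ KinB(η, |θ - cη|) + ½ (KinB(η, θ) - c Kin η) ≤ ½ (√Kin η √Kin(θ - cη) + B - cK)` by Cauchy–Schwarz
  and Beurling–Deny `Kin|u| ≤ Kin u`, and `√(K(c²K - 2cB + T)) - (cK - B) ≤ (KT - B²)/(2(cK - B)) → 0`; so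
  `limsup KinB(η, ξ_c) ≤ 0`;
* hence `s ∑ᵢ ∫ (Pᵢη) θ 𝟙{η=0} = -lim KinB(η, ξ_c) ≤ 0`, and every summand vanishes.

References: M. Reed, B. Simon, *Methods of Modern Mathematical Physics IV* (1978), §XIII.12, Thm XIII.44 and
Thms XIII.50–51 (Beurling–Deny criteria) [ReedSimonIV1978]; W. Faris, B. Simon, Duke Math. J. 42 (1975) 559–567
[FarisSimon1975].
-/

noncomputable section

open MeasureTheory Filter Set Complex UnitAddTorus
open scoped ENNReal NNReal Topology InnerProductSpace ComplexConjugate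
open Literature.Analysis.FunctionSpaces Literature.Analysis.OperatorTheory Literature.Analysis.InnerProduct

namespace Summit.AtomisticToContinuum.BoseEinsteinCondensation.Cruxes.RewardChordBound.Birth.Teleport

open Literature.MathematicalPhysics.QuantumManyBody.BoseGas
open Summit.AtomisticToContinuum.BoseEinsteinCondensation.Cruxes.HardCoreExtension.ThirdLawCurrentFloorAlt

-- The measure on `ℝ/ℤ` is the Haar PROBABILITY measure, as in `PeriodicFormDomain.lean`.
attribute [local instance] Literature.MathematicalPhysics.QuantumManyBody.BoseGas.formDomain_measureSpace
  Literature.MathematicalPhysics.QuantumManyBody.BoseGas.formDomain_isProbabilityMeasure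
  Literature.MathematicalPhysics.QuantumManyBody.BoseGas.formDomain_isProbabilityMeasure_pi

variable {N : ℕ} {L : ℝ} {v : ℝ → ℝ≥0∞}

/-- Local notation for the Hilbert space `L²((ℝ/ℤ)^{3N})`, as in `PeriodicFormDomain.lean`. -/
local notation "L2T " N':max => Lp ℂ 2 (volume : Measure (UnitAddTorus (Fin N' × Fin 3)))

/-- Local notation for the configuration torus `(ℝ/ℤ)^{N×3}`. -/
local notation "TN " N':max => UnitAddTorus (Fin N' × Fin 3)

/-! ### Algebra of the kinetic bilinear form -/

/-- The spectral weight `∑ₚ (2πnₚ/L)²` is non-negative. [folklore] -/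
theorem kinWeight_nonneg (L : ℝ) (n : Fin N × Fin 3 → ℤ) : 0 ≤ ∑ p, (2 * Real.pi * (n p : ℝ) / L) ^ 2 :=
  Finset.sum_nonneg fun _ _ => sq_nonneg _

/-- `KinB` is symmetric. [folklore] -/
theorem maxFormKinB_comm (L : ℝ) (η ξ : L2T N) : maxFormKinB L η ξ = maxFormKinB L ξ η := by
  unfold maxFormKinB
  refine tsum_congr fun n => ?_
  congr 1
  rw [← Complex.conj_re (conj ⟪(mFourierLp 2 n : L2T N), η⟫_ℂ * ⟪(mFourierLp 2 n : L2T N), ξ⟫_ℂ), map_mul,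
    Complex.conj_conj, mul_comm]

/-- `KinB(η, η) = Kin η` for finite kinetic energy. [folklore] -/
theorem maxFormKinB_self {η : L2T N} (hη : maxFormKin L η ≠ ⊤) : maxFormKinB L η η = (maxFormKin L η).toReal := by
  rw [(summable_of_maxFormKin_ne_top hη).2]
  unfold maxFormKinB
  refine tsum_congr fun n => ?_
  rw [Complex.conj_mul', ← Complex.ofReal_pow, Complex.ofReal_re]

/-- `KinB` is additive in the second argument (finite kinetic energies). [folklore] -/
theorem maxFormKinB_add_right {η a b : L2T N} (hη : maxFormKin L η ≠ ⊤) (ha : maxFormKin L a ≠ ⊤)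
    (hb : maxFormKin L b ≠ ⊤) : maxFormKinB L η (a + b) = maxFormKinB L η a + maxFormKinB L η b := by
  unfold maxFormKinB
  rw [← (summable_maxFormKinB hη ha).tsum_add (summable_maxFormKinB hη hb)]
  refine tsum_congr fun n => ?_
  rw [inner_add_right, mul_add, Complex.add_re, mul_add]

/-- `KinB(η, cξ) = c KinB(η, ξ)` for real `c`. [folklore] -/
theorem maxFormKinB_smul_right (η ξ : L2T N) (c : ℝ) :
    maxFormKinB L η ((c : ℂ) • ξ) = c * maxFormKinB L η ξ := by
  unfold maxFormKinB
  rw [← tsum_mul_left]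
  refine tsum_congr fun n => ?_
  rw [inner_smul_right, ← mul_assoc, mul_comm (conj _) (c : ℂ), mul_assoc, Complex.re_ofReal_mul]
  ring

/-- **Cauchy–Schwarz for the kinetic bilinear form**: `KinB(η, ξ)² ≤ Kin η · Kin ξ`. [folklore] -/
theorem maxFormKinB_sq_le {η ξ : L2T N} (hη : maxFormKin L η ≠ ⊤) (hξ : maxFormKin L ξ ≠ ⊤) :
    maxFormKinB L η ξ ^ 2 ≤ (maxFormKin L η).toReal * (maxFormKin L ξ).toReal := by
  have h := sq_le_mul_of_forall_quadratic_nonneg (a := (maxFormKin L ξ).toReal) (b := maxFormKinB L η ξ)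
    (c := (maxFormKin L η).toReal) fun t => ?_
  · linarith [h]
  · rw [show (maxFormKin L η).toReal + 2 * t * maxFormKinB L η ξ + t ^ 2 * (maxFormKin L ξ).toReal =
      (maxFormKin L (η + (t : ℂ) • ξ)).toReal by rw [toReal_maxFormKin_add_smul hη hξ]]
    exact ENNReal.toReal_nonneg

/-- `KinB(η, ξ) ≤ √Kin η √Kin ξ`. [folklore] -/
theorem maxFormKinB_le_sqrt_mul_sqrt {η ξ : L2T N} (hη : maxFormKin L η ≠ ⊤) (hξ : maxFormKin L ξ ≠ ⊤) :
    maxFormKinB L η ξ ≤ Real.sqrt (maxFormKin L η).toReal * Real.sqrt (maxFormKin L ξ).toReal := by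
  rw [← Real.sqrt_mul ENNReal.toReal_nonneg]
  exact (le_abs_self _).trans (Real.abs_le_sqrt (maxFormKinB_sq_le hη hξ))

/-! ### The test directions `(θ - cη)⁺` -/

section Test

variable {η θ : L2T N}

/-- `θ - cη` is real when `η, θ` are non-negative. [folklore] -/
theorem conjLp_sub_smul (hη : absLp η = η) (hθ : absLp θ = θ) (c : ℝ) :
    conjLp (θ - (c : ℂ) • η) = θ - (c : ℂ) • η := by
  refine Lp.ext ?_
  have hfη : ∀ᵐ t : TN N, (η : TN N → ℂ) t = (((‖(η : TN N → ℂ) t‖ : ℝ) : ℂ)) := by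
    have h1 := coeFn_absLp η; rw [hη] at h1; exact h1
  have hfθ : ∀ᵐ t : TN N, (θ : TN N → ℂ) t = (((‖(θ : TN N → ℂ) t‖ : ℝ) : ℂ)) := by
    have h1 := coeFn_absLp θ; rw [hθ] at h1; exact h1
  filter_upwards [coeFn_conjLp (θ - (c : ℂ) • η), Lp.coeFn_sub θ ((c : ℂ) • η), Lp.coeFn_smul (c : ℂ) η, hfη, hfθ]
    with t h1 h2 h3 h4 h5
  rw [h1, h2, Pi.sub_apply, h3, Pi.smul_apply, smul_eq_mul, h4, h5]
  simp only [map_sub, map_mul, Complex.conj_ofReal]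

/-- The positive part `(θ - cη)⁺` as half the sum of modulus and itself. [folklore] -/
theorem posPartLp_sub_smul_eq (hη : absLp η = η) (hθ : absLp θ = θ) (c : ℝ) :
    posPartLp (θ - (c : ℂ) • η) = (2⁻¹ : ℂ) • (absLp (θ - (c : ℂ) • η) + (θ - (c : ℂ) • η)) :=
  posPartLp_eq_of_conjLp_eq (conjLp_sub_smul hη hθ c)

/-- `(θ - cη)⁺` is Bose-symmetric if `η, θ` are. [folklore] -/
theorem posPartLp_sub_smul_mem_boseSymmetric (hηs : η ∈ boseSymmetric N) (hθs : θ ∈ boseSymmetric N) (c : ℝ) :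
    posPartLp (θ - (c : ℂ) • η) ∈ boseSymmetric N :=
  compLp_mem_boseSymmetric lipschitzWith_posPartC (by simp)
    ((boseSymmetric N).sub_mem hθs ((boseSymmetric N).smul_mem _ hηs))

/-- Kinetic energy of `θ - cη` is finite. [folklore] -/
theorem maxFormKin_sub_smul_ne_top (hηK : maxFormKin L η ≠ ⊤) (hθK : maxFormKin L θ ≠ ⊤) (c : ℝ) :
    maxFormKin L (θ - (c : ℂ) • η) ≠ ⊤ := by
  rw [sub_eq_add_neg, ← neg_smul]
  exact maxFormKin_add_ne_top hθK (maxFormKin_smul_ne_top _ hηK)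

/-- Potential energy of `θ - cη` is finite. [folklore] -/
theorem maxFormPot_sub_smul_ne_top (hv : Measurable v) (hηP : maxFormPot v L η ≠ ⊤) (hθP : maxFormPot v L θ ≠ ⊤)
    (c : ℝ) : maxFormPot v L (θ - (c : ℂ) • η) ≠ ⊤ := by
  rw [sub_eq_add_neg, ← neg_smul]
  exact maxFormPot_add_ne_top hv hθP (maxFormPot_smul_ne_top _ hηP)

/-- Kinetic energy of `(θ - cη)⁺` is at most that of `θ - cη` (Beurling–Deny). [cite: ReedSimonIV1978, Thm XIII.50] -/
theorem maxFormKin_posPartLp_le (u : L2T N) : maxFormKin L (posPartLp u) ≤ maxFormKin L u :=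
  maxFormKin_compLp_le_of_one lipschitzWith_posPartC (by simp) u

/-- Potential energy of `(θ - cη)⁺` is at most that of `θ - cη`. [folklore] -/
theorem maxFormPot_posPartLp_le (u : L2T N) : maxFormPot v L (posPartLp u) ≤ maxFormPot v L u :=
  maxFormPot_compLp_le lipschitzWith_posPartC (by simp) (fun z => by
    rw [Complex.norm_real, Real.norm_eq_abs, abs_of_nonneg (le_max_right _ _)]
    exact max_le (Complex.abs_re_le_norm z |>.trans' (le_abs_self _)) (norm_nonneg _)) u

/-- `(θ - cη)⁺` has finite maximal form. [folklore] -/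
theorem maxForm_posPartLp_sub_smul_ne_top (hv : Measurable v) (hηf : maxForm v L η ≠ ⊤) (hθf : maxForm v L θ ≠ ⊤)
    (c : ℝ) : maxForm v L (posPartLp (θ - (c : ℂ) • η)) ≠ ⊤ := by
  have hηK : maxFormKin L η ≠ ⊤ := ne_top_of_le_ne_top hηf (self_le_add_right _ _)
  have hθK : maxFormKin L θ ≠ ⊤ := ne_top_of_le_ne_top hθf (self_le_add_right _ _)
  have hηP : maxFormPot v L η ≠ ⊤ := ne_top_of_le_ne_top hηf (self_le_add_left _ _)
  have hθP : maxFormPot v L θ ≠ ⊤ := ne_top_of_le_ne_top hθf (self_le_add_left _ _)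
  exact ENNReal.add_ne_top.2
    ⟨ne_top_of_le_ne_top (maxFormKin_sub_smul_ne_top hηK hθK c) (maxFormKin_posPartLp_le _),
      ne_top_of_le_ne_top (maxFormPot_sub_smul_ne_top hv hηP hθP c) (maxFormPot_posPartLp_le _)⟩

/-- **The kinetic pairing against `(θ - cη)⁺` is eventually small**: for every `ε > 0` there is `c₀` with
`KinB(η, (θ - cη)⁺) ≤ ε` for all `c ≥ c₀` (Cauchy–Schwarz, Beurling–Deny, and
`√((cK - B)² + D) ≤ (cK - B) + D/(2(cK - B))`). [cite: ReedSimonIV1978, Thm XIII.50] -/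
theorem maxFormKinB_posPartLp_eventually_le (hη : absLp η = η) (hθ : absLp θ = θ)
    (hηK : maxFormKin L η ≠ ⊤) (hθK : maxFormKin L θ ≠ ⊤) {ε : ℝ} (hε : 0 < ε) :
    ∃ c₀ : ℝ, ∀ c : ℝ, c₀ ≤ c → maxFormKinB L η (posPartLp (θ - (c : ℂ) • η)) ≤ ε := by
  set K := (maxFormKin L η).toReal with hKdef
  set T := (maxFormKin L θ).toReal with hTdef
  set B := maxFormKinB L η θ with hBdef
  have hK0 : 0 ≤ K := ENNReal.toReal_nonneg
  have hT0 : 0 ≤ T := ENNReal.toReal_nonneg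
  have hCS : B ^ 2 ≤ K * T := maxFormKinB_sq_le hηK hθK
  -- the decomposition `KinB(η, u⁺) = ½ (KinB(η, |u|) + KinB(η, u))` and the bound on each half
  have hdec : ∀ c : ℝ, maxFormKinB L η (posPartLp (θ - (c : ℂ) • η)) ≤
      2⁻¹ * (Real.sqrt K * Real.sqrt (T - 2 * c * B + c ^ 2 * K) + (B - c * K)) := by
    intro c
    set u : L2T N := θ - (c : ℂ) • η with hu
    have huK : maxFormKin L u ≠ ⊤ := maxFormKin_sub_smul_ne_top hηK hθK c
    have habsK : maxFormKin L (absLp u) ≠ ⊤ :=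
      ne_top_of_le_ne_top huK (maxFormKin_compLp_le_of_one lipschitzWith_absC (by simp) u)
    have hpos : posPartLp u = ((2⁻¹ : ℝ) : ℂ) • (absLp u + u) := by
      rw [hu, posPartLp_sub_smul_eq hη hθ c]; norm_num
    rw [hpos, maxFormKinB_smul_right, maxFormKinB_add_right hηK habsK huK]
    -- `KinB(η, |u|) ≤ √K √Kin|u| ≤ √K √Kin u`
    have h1 : maxFormKinB L η (absLp u) ≤ Real.sqrt K * Real.sqrt (T - 2 * c * B + c ^ 2 * K) := by
      refine (maxFormKinB_le_sqrt_mul_sqrt hηK habsK).trans ?_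
      refine mul_le_mul_of_nonneg_left (Real.sqrt_le_sqrt ?_) (Real.sqrt_nonneg _)
      have hle := ENNReal.toReal_mono huK (maxFormKin_compLp_le_of_one lipschitzWith_absC (by simp) u)
      refine hle.trans (le_of_eq ?_)
      have hexp := toReal_maxFormKin_add_smul hθK hηK (-c)
      rw [hu, sub_eq_add_neg, ← neg_smul, ← Complex.ofReal_neg, hexp, maxFormKinB_comm L θ η]
      ring
    -- `KinB(η, u) = B - cK`
    have h2 : maxFormKinB L η u = B - c * K := by
      rw [hu, sub_eq_add_neg, ← neg_smul, ← Complex.ofReal_neg,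
        maxFormKinB_add_right hηK hθK (maxFormKin_smul_ne_top _ hηK), maxFormKinB_smul_right, maxFormKinB_self hηK]
      ring
    rw [h2]
    linarith [h1]
  -- the case `K = 0`: then `B = 0` and the bound is `½ · 0`
  rcases hK0.eq_or_lt with hK | hKpos
  · have hB : B = 0 := by
      have h : B ^ 2 ≤ 0 := by rw [← hK, zero_mul] at hCS; exact hCS
      exact pow_eq_zero_iff two_ne_zero |>.1 (le_antisymm h (sq_nonneg _))
    refine ⟨0, fun c _ => (hdec c).trans ?_⟩
    rw [← hK, hB]
    simp only [Real.sqrt_zero, zero_mul, mul_zero, sub_zero, add_zero]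
    linarith
  -- the case `K > 0`
  set D := K * T - B ^ 2 with hDdef
  have hD0 : 0 ≤ D := by rw [hDdef]; linarith
  refine ⟨(B + 1 + D / (4 * ε)) / K, fun c hc => (hdec c).trans ?_⟩
  have hcK : B + 1 + D / (4 * ε) ≤ c * K := by rwa [div_le_iff₀ hKpos] at hc
  have ha : 0 < c * K - B := by
    have : 0 ≤ D / (4 * ε) := div_nonneg hD0 (by positivity)
    linarith
  -- `√(K(c²K - 2cB + T)) = √((cK - B)² + D) ≤ (cK - B) + D/(2(cK - B))`
  have hsq : Real.sqrt K * Real.sqrt (T - 2 * c * B + c ^ 2 * K) ≤ (c * K - B) + D / (2 * (c * K - B)) := by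
    rw [← Real.sqrt_mul hK0]
    have heq : K * (T - 2 * c * B + c ^ 2 * K) = (c * K - B) ^ 2 + D := by rw [hDdef]; ring
    rw [heq]
    refine Real.sqrt_le_iff.2 ⟨by positivity, ?_⟩
    have hx : ((c * K - B) + D / (2 * (c * K - B))) ^ 2 =
        (c * K - B) ^ 2 + D + (D / (2 * (c * K - B))) ^ 2 := by
      field_simp
      ring
    rw [hx]
    linarith [sq_nonneg (D / (2 * (c * K - B)))]
  have hfin : D / (2 * (c * K - B)) ≤ 2 * ε := by
    rw [div_le_iff₀ (by positivity)]
    have h4 : D / (4 * ε) ≤ c * K - B - 1 := by linarith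
    have h5 : D ≤ (c * K - B - 1) * (4 * ε) := by rwa [div_le_iff₀ (by positivity)] at h4
    nlinarith
  linarith

end Test

/-! ### Pointwise behaviour of the test directions -/

section Pointwise

variable {η θ : L2T N}

/-- The a.e. representative of `(θ - nη)⁺` for non-negative `η, θ`: `max(|θ| - n|η|, 0)`. [folklore] -/
theorem coeFn_posPartLp_sub_smul (hη : absLp η = η) (hθ : absLp θ = θ) (c : ℝ) :
    ∀ᵐ t : TN N, (posPartLp (θ - (c : ℂ) • η) : TN N → ℂ) t =
      ((max (‖(θ : TN N → ℂ) t‖ - c * ‖(η : TN N → ℂ) t‖) 0 : ℝ) : ℂ) := by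
  have hfη : ∀ᵐ t : TN N, (η : TN N → ℂ) t = (((‖(η : TN N → ℂ) t‖ : ℝ) : ℂ)) := by
    have h1 := coeFn_absLp η; rw [hη] at h1; exact h1
  have hfθ : ∀ᵐ t : TN N, (θ : TN N → ℂ) t = (((‖(θ : TN N → ℂ) t‖ : ℝ) : ℂ)) := by
    have h1 := coeFn_absLp θ; rw [hθ] at h1; exact h1
  filter_upwards [coeFn_posPartLp (θ - (c : ℂ) • η), Lp.coeFn_sub θ ((c : ℂ) • η), Lp.coeFn_smul (c : ℂ) η, hfη, hfθ]
    with t h1 h2 h3 h4 h5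
  rw [h1, h2, Pi.sub_apply, h3, Pi.smul_apply, smul_eq_mul, h4, h5]
  congr 2
  rw [Complex.sub_re, Complex.ofReal_re, Complex.re_ofReal_mul, Complex.ofReal_re, Complex.norm_real, Complex.norm_real,
    norm_norm, norm_norm]

/-- `|(θ - cη)⁺| ≤ |θ|` pointwise a.e. (`c ≥ 0`). [folklore] -/
theorem norm_coeFn_posPartLp_sub_smul_le (hη : absLp η = η) (hθ : absLp θ = θ) {c : ℝ} (hc : 0 ≤ c) :
    ∀ᵐ t : TN N, ‖(posPartLp (θ - (c : ℂ) • η) : TN N → ℂ) t‖ ≤ ‖(θ : TN N → ℂ) t‖ := by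
  filter_upwards [coeFn_posPartLp_sub_smul hη hθ c] with t ht
  rw [ht, Complex.norm_real, Real.norm_eq_abs, abs_of_nonneg (le_max_right _ _)]
  refine max_le ?_ (norm_nonneg _)
  nlinarith [norm_nonneg ((η : TN N → ℂ) t)]

/-- **Pointwise limit of the test directions**: `(θ - nη)⁺ → θ𝟙{η = 0}` (eventually constant at every point).
[folklore] -/
theorem tendsto_coeFn_posPartLp_sub_smul (hη : absLp η = η) (hθ : absLp θ = θ) :
    ∀ᵐ t : TN N, Tendsto (fun n : ℕ => (posPartLp (θ - ((n : ℝ) : ℂ) • η) : TN N → ℂ) t) atTop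
      (𝓝 (if ‖(η : TN N → ℂ) t‖ = 0 then (((‖(θ : TN N → ℂ) t‖ : ℝ) : ℂ)) else 0)) := by
  have hall : ∀ᵐ t : TN N, ∀ n : ℕ, (posPartLp (θ - ((n : ℝ) : ℂ) • η) : TN N → ℂ) t =
      ((max (‖(θ : TN N → ℂ) t‖ - n * ‖(η : TN N → ℂ) t‖) 0 : ℝ) : ℂ) :=
    ae_all_iff.2 fun n => coeFn_posPartLp_sub_smul hη hθ n
  filter_upwards [hall] with t ht
  simp only [ht]
  split_ifs with h0
  · rw [h0]
    simp only [mul_zero, sub_zero, max_eq_left (norm_nonneg _)]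
    exact tendsto_const_nhds
  · have hpos : 0 < ‖(η : TN N → ℂ) t‖ := (norm_nonneg _).lt_of_ne (Ne.symm h0)
    obtain ⟨n₀, hn₀⟩ := exists_nat_ge (‖(θ : TN N → ℂ) t‖ / ‖(η : TN N → ℂ) t‖)
    refine tendsto_atTop_of_eventually_const (i₀ := n₀) fun n hn => ?_
    have hn' : ‖(θ : TN N → ℂ) t‖ / ‖(η : TN N → ℂ) t‖ ≤ n := hn₀.trans (Nat.cast_le.2 hn)
    rw [div_le_iff₀ hpos] at hn'
    rw [max_eq_right (by linarith), Complex.ofReal_zero]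

end Pointwise

end Summit.AtomisticToContinuum.BoseEinsteinCondensation.Cruxes.RewardChordBound.Birth.Teleport

namespace Summit.AtomisticToContinuum.BoseEinsteinCondensation.Cruxes.RewardChordBound.Birth

open Summit.AtomisticToContinuum.BoseEinsteinCondensation.Cruxes.RewardChordBound.Birth.Teleport
  Literature.MathematicalPhysics.QuantumManyBody.BoseGas

/-- **Registered sub-goal of stub `stub_teleportPackage` (helper file 2a, test directions).** For non-negative
`η, θ` in `L²` of the torus with finite kinetic energy and `ε > 0` there is `c₀` with `KinB(η, (θ - cη)⁺) ≤ ε` for all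
`c ≥ c₀` (Cauchy–Schwarz + Beurling–Deny; explicit Haar product measure, definitionally the package's `L2T N`).
[cite: ReedSimonIV1978, Thm XIII.50] -/
theorem stub_teleportPackage_TestDirections :
    ∀ (N : ℕ) (L : ℝ) (η θ : MeasureTheory.Lp ℂ 2 (MeasureTheory.Measure.pi fun _ : Fin N × Fin 3 =>
          (AddCircle.haarAddCircle : MeasureTheory.Measure UnitAddCircle))),
      Literature.MathematicalPhysics.QuantumManyBody.BoseGas.absLp η = η → Literature.MathematicalPhysics.QuantumManyBody.BoseGas.absLp θ = θ →
      Literature.MathematicalPhysics.QuantumManyBody.BoseGas.maxFormKin L η ≠ ⊤ → Literature.MathematicalPhysics.QuantumManyBody.BoseGas.maxFormKin L θ ≠ ⊤ →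
      ∀ ε : ℝ, 0 < ε → ∃ c₀ : ℝ, ∀ c : ℝ, c₀ ≤ c →
        Literature.MathematicalPhysics.QuantumManyBody.BoseGas.maxFormKinB L η (Literature.MathematicalPhysics.QuantumManyBody.BoseGas.posPartLp (θ - (c : ℂ) • η)) ≤ ε :=
  fun _ _ _ _ hη hθ hηK hθK _ hε => maxFormKinB_posPartLp_eventually_le hη hθ hηK hθK hε

end Summit.AtomisticToContinuum.BoseEinsteinCondensation.Cruxes.RewardChordBound.Birth

end
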